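import Summits.QuantumFields.YangMills.Theorems.ColdStartUniversalityLatticeLangevinGradientDriftCore
import HarnessLib

/-!
# Route `ColdStartUniversality`, crux K_A1 `UniformColdStartMixing` (stmt-QuantumFields-24809), rung `stub_fixedCutoffMixing`:
# G-block, brick G1b (plaquette combinatorics) — SZZ Lemma 3.1 in matrix form

Helper file (seat `ym-line-csu-p1`, g7).  For a matrix link configuration `Q`, a link `e = (x, i)` and a skew-Hermitian `A`,
the derivative at `s = 0` of the plaquette sum `Σ_p Re tr(Q^s_p)` along the right-trivialised perturbation
`Q^s = Q + s δ_e(A Q_e)` is `Σ_{j ≠ i} Σ_b Re tr(A · rootedLoop Q e j b)` (`hasDerivAt_sum_re_trace_plaquette`): the four slots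
of the plaquette words through `e` are re-indexed by the `2(d-1)` rooted loops (slots 1/4 ↦ the loops `false`, slots 2/3 ↦ the
loops `true`).  With `driftLie_eq_sum_lieProj_noiseDir` (Core) this is SZZ Lemma 3.1, `∇𝒮(Q)_e = [β Σ_{p ≻ e} 𝐩(Q_pᴴ)] Q_e`.
No definition, no sorry.  RECORD-rung R3 plumbing; nothing here bears on the mass gap.
-/

set_option autoImplicit false

noncomputable section

namespace Summit.QuantumFields.YangMills.Theorems.ColdStartUniversality

open Finset Matrix Complex
open scoped BigOperators Matrix ComplexConjugate
open Literature.MathematicalPhysics.QuantumFieldTheory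

/-! ### The four slots of a plaquette word -/

/-- Slot 1: `Re tr((A Y) F₂ F₃ F₄) = Re tr(A · Y F₂ F₃ F₄)`. [folklore] -/
theorem re_trace_slot1 {N : ℕ} (A Y F₂ F₃ F₄ : Matrix (Fin N) (Fin N) ℂ) :
    (A * Y * F₂ * F₃ * F₄).trace.re = (A * (Y * F₂ * F₃ * F₄)).trace.re := by
  simp only [Matrix.mul_assoc]

/-- Slot 2: `Re tr(F₁ (A Y) F₃ F₄) = Re tr(A · Y F₃ F₄ F₁)`. [folklore] -/
theorem re_trace_slot2 {N : ℕ} (A Y F₁ F₃ F₄ : Matrix (Fin N) (Fin N) ℂ) :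
    (F₁ * (A * Y) * F₃ * F₄).trace.re = (A * (Y * F₃ * F₄ * F₁)).trace.re := by
  rw [Matrix.mul_assoc (F₁ * (A * Y)), re_trace_mul_mul_mul_cycle]
  simp only [Matrix.mul_assoc]

/-- Slot 3 (reversed, skew-Hermitian `A`): `Re tr(F₁ F₂ (A Y)ᴴ F₄) = Re tr(A · Y F₂ᴴ F₁ᴴ F₄ᴴ)`. [folklore] -/
theorem re_trace_slot3 {N : ℕ} {A : Matrix (Fin N) (Fin N) ℂ} (hA : Aᴴ = -A) (Y F₁ F₂ F₄ : Matrix (Fin N) (Fin N) ℂ) :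
    (F₁ * F₂ * (A * Y)ᴴ * F₄).trace.re = (A * (Y * F₂ᴴ * F₁ᴴ * F₄ᴴ)).trace.re := by
  rw [re_trace_mul_conjTranspose_mul_of_skew hA, Matrix.conjTranspose_mul]
  simp only [Matrix.mul_assoc]

/-- Slot 4 (reversed, skew-Hermitian `A`): `Re tr(F₁ F₂ F₃ (A Y)ᴴ) = Re tr(A · Y F₃ᴴ F₂ᴴ F₁ᴴ)`. [folklore] -/
theorem re_trace_slot4 {N : ℕ} {A : Matrix (Fin N) (Fin N) ℂ} (hA : Aᴴ = -A) (Y F₁ F₂ F₃ : Matrix (Fin N) (Fin N) ℂ) :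
    (F₁ * F₂ * F₃ * (A * Y)ᴴ).trace.re = (A * (Y * F₃ᴴ * F₂ᴴ * F₁ᴴ)).trace.re := by
  rw [re_trace_mul_conjTranspose_of_skew' hA, Matrix.conjTranspose_mul, Matrix.conjTranspose_mul]
  simp only [Matrix.mul_assoc]

/-! ### Re-indexing plaquette slots by rooted loops -/

/-- Collapsing the site sum: a plaquette summand supported on `p.1 = φ(p.2)`. [folklore] -/
theorem sum_plaquette_ite_site {d L : ℕ} [NeZero L] (φ : {q : Fin d × Fin d // q.1 < q.2} → Site d L)
    (P : {q : Fin d × Fin d // q.1 < q.2} → Prop) [DecidablePred P] (g : {q : Fin d × Fin d // q.1 < q.2} → ℝ) :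
    ∑ p : Plaquette d L, (if p.1 = φ p.2 ∧ P p.2 then g p.2 else 0) =
      ∑ q : {q : Fin d × Fin d // q.1 < q.2}, (if P q then g q else 0) := by
  classical
  rw [Fintype.sum_prod_type, Finset.sum_comm]
  refine Finset.sum_congr rfl fun q _ => ?_
  simp_rw [ite_and]
  rw [Finset.sum_ite_eq' univ (φ q), if_pos (mem_univ _)]

/-- Collapsing the site sum, slot-2 shape (`p.1 = x₀ - e_k`, `k` the first direction). [folklore] -/
theorem sum_plaquette_ite_site_fst {d L : ℕ} [NeZero L] (x₀ : Site d L)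
    (P : {q : Fin d × Fin d // q.1 < q.2} → Prop) [DecidablePred P] (g : {q : Fin d × Fin d // q.1 < q.2} → ℝ) :
    ∑ p : Plaquette d L, (if p.1 = x₀ - Pi.single p.2.1.1 1 ∧ P p.2 then g p.2 else 0) =
      ∑ q : {q : Fin d × Fin d // q.1 < q.2}, (if P q then g q else 0) := by
  exact sum_plaquette_ite_site (fun q => x₀ - Pi.single q.1.1 1) P g

/-- Collapsing the site sum, slot-3 shape (`p.1 = x₀ - e_l`, `l` the second direction). [folklore] -/
theorem sum_plaquette_ite_site_snd {d L : ℕ} [NeZero L] (x₀ : Site d L)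
    (P : {q : Fin d × Fin d // q.1 < q.2} → Prop) [DecidablePred P] (g : {q : Fin d × Fin d // q.1 < q.2} → ℝ) :
    ∑ p : Plaquette d L, (if p.1 = x₀ - Pi.single p.2.1.2 1 ∧ P p.2 then g p.2 else 0) =
      ∑ q : {q : Fin d × Fin d // q.1 < q.2}, (if P q then g q else 0) := by
  exact sum_plaquette_ite_site (fun q => x₀ - Pi.single q.1.2 1) P g

/-- Ordered pairs with prescribed first component: `Σ_{k<l, k = i} g(l) = Σ_{l > i} g(l)`. [folklore] -/
theorem sum_klt_ite_fst {d : ℕ} (i : Fin d) (g : Fin d → ℝ) :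
    ∑ q : {q : Fin d × Fin d // q.1 < q.2}, (if q.1.1 = i then g q.1.2 else 0) =
      ∑ l ∈ univ.filter (fun l => i < l), g l := by
  classical
  rw [← Finset.sum_subtype (univ.filter fun q : Fin d × Fin d => q.1 < q.2) (by simp)
    (fun q : Fin d × Fin d => if q.1 = i then g q.2 else 0), Finset.sum_filter, Fintype.sum_prod_type, Finset.sum_comm,
    Finset.sum_filter]
  refine Finset.sum_congr rfl fun l _ => ?_
  have h : ∀ k : Fin d, (if k < l then (if k = i then g l else 0) else 0) = if k = i then (if i < l then g l else 0) else 0 := by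
    intro k; by_cases hk : k = i
    · subst hk; simp
    · simp [hk]
  simp_rw [h]
  rw [Finset.sum_ite_eq' univ i, if_pos (mem_univ _)]

/-- Ordered pairs with prescribed second component: `Σ_{k<l, l = i} g(k) = Σ_{k < i} g(k)`. [folklore] -/
theorem sum_klt_ite_snd {d : ℕ} (i : Fin d) (g : Fin d → ℝ) :
    ∑ q : {q : Fin d × Fin d // q.1 < q.2}, (if q.1.2 = i then g q.1.1 else 0) =
      ∑ k ∈ univ.filter (fun k => k < i), g k := by
  classical
  rw [← Finset.sum_subtype (univ.filter fun q : Fin d × Fin d => q.1 < q.2) (by simp)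
    (fun q : Fin d × Fin d => if q.2 = i then g q.1 else 0), Finset.sum_filter, Fintype.sum_prod_type, Finset.sum_filter]
  refine Finset.sum_congr rfl fun k _ => ?_
  have h : ∀ l : Fin d, (if k < l then (if l = i then g k else 0) else 0) = if l = i then (if k < i then g k else 0) else 0 := by
    intro l; by_cases hl : l = i
    · subst hl; simp
    · simp [hl]
  simp_rw [h]
  rw [Finset.sum_ite_eq' univ i, if_pos (mem_univ _)]

/-- `Σ_{j ≠ i} h(j) = Σ_{j < i} h(j) + Σ_{j > i} h(j)`. [folklore] -/
theorem sum_erase_eq_sum_lt_add_sum_gt {d : ℕ} (i : Fin d) (h : Fin d → ℝ) :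
    ∑ j ∈ univ.erase i, h j = ∑ j ∈ univ.filter (fun j => j < i), h j + ∑ j ∈ univ.filter (fun j => i < j), h j := by
  classical
  rw [← Finset.sum_filter_add_sum_filter_not (univ.erase i) (fun j => j < i)]
  congr 1
  · congr 1; ext j; simp only [mem_filter, mem_erase, mem_univ, and_true, true_and, ne_eq]
    exact ⟨fun h => h.2, fun h => ⟨ne_of_lt h, h⟩⟩
  · congr 1; ext j; simp only [mem_filter, mem_erase, mem_univ, and_true, true_and, ne_eq]
    constructor
    · rintro ⟨hne, hnl⟩; exact lt_of_le_of_ne (not_lt.1 hnl) (Ne.symm hne)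
    · intro hlt; exact ⟨ne_of_gt hlt, not_lt.2 hlt.le⟩

/-! ### SZZ Lemma 3.1, matrix form -/

/-- The four slot sums re-indexed by rooted loops: slots 1 and 4 give the loops `false`, slots 2 and 3 the loops `true`. [folklore] -/
theorem sum_four_slots_eq {d L N : ℕ} [NeZero L] (Q : MatrixConfig d L N) (e : Edge d L) (A : Matrix (Fin N) (Fin N) ℂ) :
    (∑ p : Plaquette d L, (if p.1 = e.1 ∧ p.2.1.1 = e.2 then (A * rootedLoop Q e p.2.1.2 false).trace.re else 0)) +
      (∑ p : Plaquette d L, (if p.1 = e.1 - Pi.single p.2.1.1 1 ∧ p.2.1.2 = e.2 then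
        (A * rootedLoop Q e p.2.1.1 true).trace.re else 0)) +
      (∑ p : Plaquette d L, (if p.1 = e.1 - Pi.single p.2.1.2 1 ∧ p.2.1.1 = e.2 then
        (A * rootedLoop Q e p.2.1.2 true).trace.re else 0)) +
      (∑ p : Plaquette d L, (if p.1 = e.1 ∧ p.2.1.2 = e.2 then (A * rootedLoop Q e p.2.1.1 false).trace.re else 0)) =
      ∑ j ∈ univ.erase e.2, ∑ b : Bool, (A * rootedLoop Q e j b).trace.re := by
  rw [sum_plaquette_ite_site (fun _ => e.1) (fun q => q.1.1 = e.2) (fun q => (A * rootedLoop Q e q.1.2 false).trace.re),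
    sum_plaquette_ite_site_fst e.1 (fun q => q.1.2 = e.2) (fun q => (A * rootedLoop Q e q.1.1 true).trace.re),
    sum_plaquette_ite_site_snd e.1 (fun q => q.1.1 = e.2) (fun q => (A * rootedLoop Q e q.1.2 true).trace.re),
    sum_plaquette_ite_site (fun _ => e.1) (fun q => q.1.2 = e.2) (fun q => (A * rootedLoop Q e q.1.1 false).trace.re),
    sum_klt_ite_fst e.2 (fun l => (A * rootedLoop Q e l false).trace.re),
    sum_klt_ite_snd e.2 (fun k => (A * rootedLoop Q e k true).trace.re),
    sum_klt_ite_fst e.2 (fun l => (A * rootedLoop Q e l true).trace.re),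
    sum_klt_ite_snd e.2 (fun k => (A * rootedLoop Q e k false).trace.re),
    sum_erase_eq_sum_lt_add_sum_gt]
  simp only [Fintype.sum_bool, Finset.sum_add_distrib]
  ring

/-- `x.shift k = y ↔ x = y - e_k`. [folklore] -/
theorem Site_shift_eq_iff {d L : ℕ} (x y : Site d L) (k : Fin d) : x.shift k = y ↔ x = y - Pi.single k 1 := by
  rw [Site.shift, eq_sub_iff_add_eq]

/-- **SZZ Lemma 3.1 (matrix form).**  For skew-Hermitian `A`, the derivative at `s = 0` of `Σ_p Re tr(rootedLoop Q^s p false)`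
along `Q^s = Q + s δ_e(A Q_e)` is `Σ_{j ≠ e.2} Σ_b Re tr(A · rootedLoop Q e j b)`. [cite: ShenZhuZhu2022, §3 Lemma 3.1] -/
theorem hasDerivAt_sum_re_trace_plaquette {d L N : ℕ} [NeZero L] (Q : MatrixConfig d L N) (e : Edge d L)
    {A : Matrix (Fin N) (Fin N) ℂ} (hA : Aᴴ = -A) :
    HasDerivAt (fun s : ℝ => ∑ p : Plaquette d L,
        (rootedLoop (fun e' => Q e' + (s : ℂ) • (Pi.single e (A * Q e) : MatrixConfig d L N) e')
          (p.1, p.2.1.1) p.2.1.2 false).trace.re)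
      (∑ j ∈ univ.erase e.2, ∑ b : Bool, (A * rootedLoop Q e j b).trace.re) 0 := by
  classical
  set D : MatrixConfig d L N := Pi.single e (A * Q e) with hD
  have hsum := HasDerivAt.fun_sum (u := (univ : Finset (Plaquette d L)))
    fun p _ => hasDerivAt_re_trace_rootedLoop_false Q D (p.1, p.2.1.1) p.2.1.2
  refine hsum.congr_deriv ?_
  have hDe : D e = A * Q e := by rw [hD, Pi.single_eq_same]
  have hDne : ∀ e' : Edge d L, e' ≠ e → D e' = 0 := fun e' he' => by rw [hD, Pi.single_eq_of_ne he']
  have hpair : ∀ (x : Site d L) (k : Fin d), ((x, k) : Edge d L) = e ↔ x = e.1 ∧ k = e.2 := fun x k => by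
    rw [Prod.ext_iff]
  -- the four slots as indicator summands
  have hT1 : ∀ p : Plaquette d L,
      (D (p.1, p.2.1.1) * Q (p.1.shift p.2.1.1, p.2.1.2) * (Q (p.1.shift p.2.1.2, p.2.1.1))ᴴ * (Q (p.1, p.2.1.2))ᴴ).trace.re =
        if p.1 = e.1 ∧ p.2.1.1 = e.2 then (A * rootedLoop Q e p.2.1.2 false).trace.re else 0 := by
    intro p
    by_cases h : p.1 = e.1 ∧ p.2.1.1 = e.2
    · rw [if_pos h]
      obtain ⟨h1, h2⟩ := h
      rw [h1, h2, Prod.mk.eta, hDe, re_trace_slot1]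
      simp only [rootedLoop]
    · rw [if_neg h, hDne _ (fun h' => h ((hpair _ _).1 h'))]
      simp
  have hT2 : ∀ p : Plaquette d L,
      (Q (p.1, p.2.1.1) * D (p.1.shift p.2.1.1, p.2.1.2) * (Q (p.1.shift p.2.1.2, p.2.1.1))ᴴ * (Q (p.1, p.2.1.2))ᴴ).trace.re =
        if p.1 = e.1 - Pi.single p.2.1.1 1 ∧ p.2.1.2 = e.2 then (A * rootedLoop Q e p.2.1.1 true).trace.re else 0 := by
    intro p
    by_cases h : p.1 = e.1 - Pi.single p.2.1.1 1 ∧ p.2.1.2 = e.2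
    · rw [if_pos h]
      obtain ⟨h1, h2⟩ := h
      have hs : p.1.shift p.2.1.1 = e.1 := (Site_shift_eq_iff _ _ _).2 h1
      rw [hs, h2, Prod.mk.eta, hDe, re_trace_slot2, h1]
      simp only [rootedLoop]
    · have hne : ((p.1.shift p.2.1.1, p.2.1.2) : Edge d L) ≠ e := fun h' => by
        rw [hpair] at h'
        exact h ⟨(Site_shift_eq_iff _ _ _).1 h'.1, h'.2⟩
      rw [if_neg h, hDne _ hne]
      simp
  have hT3 : ∀ p : Plaquette d L,
      (Q (p.1, p.2.1.1) * Q (p.1.shift p.2.1.1, p.2.1.2) * (D (p.1.shift p.2.1.2, p.2.1.1))ᴴ * (Q (p.1, p.2.1.2))ᴴ).trace.re =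
        if p.1 = e.1 - Pi.single p.2.1.2 1 ∧ p.2.1.1 = e.2 then (A * rootedLoop Q e p.2.1.2 true).trace.re else 0 := by
    intro p
    by_cases h : p.1 = e.1 - Pi.single p.2.1.2 1 ∧ p.2.1.1 = e.2
    · rw [if_pos h]
      obtain ⟨h1, h2⟩ := h
      have hs : p.1.shift p.2.1.2 = e.1 := (Site_shift_eq_iff _ _ _).2 h1
      rw [hs, h2, Prod.mk.eta, hDe, re_trace_slot3 hA, h1]
      simp only [rootedLoop, Matrix.conjTranspose_conjTranspose]
    · have hne : ((p.1.shift p.2.1.2, p.2.1.1) : Edge d L) ≠ e := fun h' => by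
        rw [hpair] at h'
        exact h ⟨(Site_shift_eq_iff _ _ _).1 h'.1, h'.2⟩
      rw [if_neg h, hDne _ hne]
      simp
  have hT4 : ∀ p : Plaquette d L,
      (Q (p.1, p.2.1.1) * Q (p.1.shift p.2.1.1, p.2.1.2) * (Q (p.1.shift p.2.1.2, p.2.1.1))ᴴ * (D (p.1, p.2.1.2))ᴴ).trace.re =
        if p.1 = e.1 ∧ p.2.1.2 = e.2 then (A * rootedLoop Q e p.2.1.1 false).trace.re else 0 := by
    intro p
    by_cases h : p.1 = e.1 ∧ p.2.1.2 = e.2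
    · rw [if_pos h]
      obtain ⟨h1, h2⟩ := h
      rw [h1, h2, Prod.mk.eta, hDe, re_trace_slot4 hA]
      simp only [rootedLoop, Matrix.conjTranspose_conjTranspose]
    · rw [if_neg h, hDne _ (fun h' => h ((hpair _ _).1 h'))]
      simp
  dsimp only
  simp_rw [hT1, hT2, hT3, hT4]
  rw [Finset.sum_add_distrib, Finset.sum_add_distrib, Finset.sum_add_distrib]
  exact sum_four_slots_eq Q e A

end Summit.QuantumFields.YangMills.Theorems.ColdStartUniversality

end
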